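import Mathlib

/-!
# Crux `GappedShellCensus.FiveFoldRationingR` (stmt-AtomisticToContinuum-18071), line `Sketch` —
# stub `stub_ffrQuasiGlue`: height function + greedy routing ⇒ uniform quasi-geodesy of five-fold walks

Write `B = a (1 + 1/50)` and `FB y` for the five-bond partners of a site `y` of `Y ⊆ ℝ³` (bond partners
`v ≠ y`, `dist y v ≤ B`, with `≥ 5` common bond partners).  Assume
* the hard core of gapped-twelve (`dist ≥ 0.98 a` between distinct sites),
* no branching (`FB y = ∅` or `(FB y).ncard = 2`; only used through the midpoint property below),
* GREEDY ROUTING: any two sites `u, v` are joined by a bond path in `Y` of length `≤ 4 · dist u v / a + 3`,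
* a HEIGHT FUNCTION `h`: `|h u - h v| ≤ 1` on bonds, `|h y - h v| = 1` on five-bonds, and
  `h v + h v' = 2 h y` for the two distinct five-bond partners `v, v'` of a site `y`.
Then every non-backtracking five-fold walk `f` satisfies `(a/10) · |i - j| ≤ dist (f i) (f j)`.

Proof.  Along `f` the height climbs by a constant `δ = h (f 1) - h (f 0) = ±1` (midpoint property at
`f (n+1)`, whose two five-bond partners are `f n ≠ f (n+2)`), so `|h (f i) - h (f j)| = |i - j|`; a bond
path of length `n` changes `h` by at most `n`, so `|i - j| ≤ 4 · dist / a + 3`; for `|i - j| ≤ 9` the hard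
core `dist ≥ 0.98 a ≥ 0.9 a` suffices, for `|i - j| > 9` the linear bound does.  The walk and path lemmas
are stated for an abstract partner map `FB : E → Set E`.
-/

noncomputable section

namespace Summit.AtomisticToContinuum.Crystallization.Theorems

/-- **Linear climb.** For a partner map `FB` (partners of sites are sites, partnership symmetric on `Y`)
and a height `h` with the midpoint property `h v + h v' = 2 h y` for distinct partners `v, v'` of `y`,
a non-backtracking `FB`-walk `f` in `Y` has `h (f n) = h (f 0) + n · (h (f 1) - h (f 0))`. [folklore] -/
theorem ffrQG_walk_height {E : Type*} (Y : Set E) (FB : E → Set E) (h : E → ℝ)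
    (hsymm : ∀ y ∈ Y, ∀ v ∈ FB y, y ∈ FB v)
    (h2 : ∀ y ∈ Y, ∀ v ∈ FB y, ∀ v' ∈ FB y, v ≠ v' → h v + h v' = 2 * h y)
    {f : ℕ → E} (hfY : ∀ n, f n ∈ Y) (hfS : ∀ n, f (n + 1) ∈ FB (f n))
    (hfB : ∀ n, f (n + 2) ≠ f n) :
    ∀ n, h (f n) = h (f 0) + n * (h (f 1) - h (f 0)) := by
  -- consecutive differences are constant
  have hstep : ∀ n, h (f (n + 2)) - h (f (n + 1)) = h (f (n + 1)) - h (f n) := by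
    intro n
    have hv : f n ∈ FB (f (n + 1)) := hsymm (f n) (hfY n) (f (n + 1)) (hfS n)
    have hv' : f (n + 2) ∈ FB (f (n + 1)) := hfS (n + 1)
    have hne : f n ≠ f (n + 2) := fun e => hfB n e.symm
    have := h2 (f (n + 1)) (hfY (n + 1)) (f n) hv (f (n + 2)) hv' hne
    linarith
  have hdiff : ∀ n, h (f (n + 1)) - h (f n) = h (f 1) - h (f 0) := by
    intro n
    induction n with
    | zero => simp
    | succ m ih => rw [show m + 1 + 1 = m + 2 by ring, hstep m, ih]
  intro n
  induction n with
  | zero => simp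
  | succ m ih =>
    have := hdiff m
    push_cast
    linarith

/-- **Bond paths change the height by at most their length.** If `|h u - h v| ≤ 1` whenever
`u, v ∈ Y` with `dist u v ≤ B`, then along `g : ℕ → Y` with `dist (g k) (g (k+1)) ≤ B` for `k < n`
one has `|h (g n) - h (g 0)| ≤ n`. [folklore] -/
theorem ffrQG_path_height {E : Type*} [PseudoMetricSpace E] (Y : Set E) (B : ℝ) (h : E → ℝ)
    (hlip : ∀ u ∈ Y, ∀ v ∈ Y, dist u v ≤ B → |h u - h v| ≤ 1) {g : ℕ → E} (hgY : ∀ k, g k ∈ Y)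
    {n : ℕ} (hg : ∀ k, k < n → dist (g k) (g (k + 1)) ≤ B) : |h (g n) - h (g 0)| ≤ n := by
  induction n with
  | zero => simp
  | succ m ih =>
    have h1 : |h (g m) - h (g 0)| ≤ m := ih fun k hk => hg k (Nat.lt_succ_of_lt hk)
    have h2 : |h (g (m + 1)) - h (g m)| ≤ 1 := by
      rw [abs_sub_comm]
      exact hlip (g m) (hgY m) (g (m + 1)) (hgY (m + 1)) (hg m (Nat.lt_succ_self m))
    calc |h (g (m + 1)) - h (g 0)| = |(h (g (m + 1)) - h (g m)) + (h (g m) - h (g 0))| := by ring_nf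
      _ ≤ |h (g (m + 1)) - h (g m)| + |h (g m) - h (g 0)| := abs_add_le _ _
      _ ≤ 1 + m := add_le_add h2 h1
      _ = (m + 1 : ℕ) := by push_cast; ring

/-- **Stub `stub_ffrQuasiGlue` (glue).** Hard core + greedy routing + a height function (bond-Lipschitz, unit
climb on five-bonds, midpoint property at every site) ⇒ every non-backtracking five-fold walk is
`(a/10)`-quasi-geodesic, uniformly. [folklore] -/
theorem stub_ffrQuasiGlue :
    ∀ (Y : Set (EuclideanSpace ℝ (Fin 3))) (a : ℝ), 0 < a →
      (∀ y ∈ Y, ({w ∈ Y | w ≠ y ∧ dist y w ≤ a * (1 + 1 / 50)}.ncard = 12 ∧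
        ∀ w ∈ Y, w ≠ y → a * (1 - 1 / 50) ≤ dist y w ∧
          (dist y w ≤ a * (1 + 1 / 50) ∨ a * (63 / 50) ≤ dist y w))) →
      (∀ u ∈ Y, ∀ v ∈ Y, ∃ (n : ℕ) (g : ℕ → EuclideanSpace ℝ (Fin 3)), g 0 = u ∧ g n = v ∧ (∀ k, g k ∈ Y) ∧
        (∀ k, k < n → dist (g k) (g (k + 1)) ≤ a * (1 + 1 / 50)) ∧ (n : ℝ) ≤ 4 * dist u v / a + 3) →
      (∃ h : EuclideanSpace ℝ (Fin 3) → ℝ,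
        (∀ u ∈ Y, ∀ v ∈ Y, dist u v ≤ a * (1 + 1 / 50) → |h u - h v| ≤ 1) ∧
        (∀ y ∈ Y, ∀ v ∈ {v ∈ Y | v ≠ y ∧ dist y v ≤ a * (1 + 1 / 50) ∧
          5 ≤ {w ∈ Y | w ≠ y ∧ w ≠ v ∧ dist y w ≤ a * (1 + 1 / 50) ∧
            dist v w ≤ a * (1 + 1 / 50)}.ncard},
          |h y - h v| = 1) ∧
        (∀ y ∈ Y, ∀ v ∈ {v ∈ Y | v ≠ y ∧ dist y v ≤ a * (1 + 1 / 50) ∧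
          5 ≤ {w ∈ Y | w ≠ y ∧ w ≠ v ∧ dist y w ≤ a * (1 + 1 / 50) ∧
            dist v w ≤ a * (1 + 1 / 50)}.ncard},
          ∀ v' ∈ {v ∈ Y | v ≠ y ∧ dist y v ≤ a * (1 + 1 / 50) ∧
          5 ≤ {w ∈ Y | w ≠ y ∧ w ≠ v ∧ dist y w ≤ a * (1 + 1 / 50) ∧
            dist v w ≤ a * (1 + 1 / 50)}.ncard},
          v ≠ v' → h v + h v' = 2 * h y)) →
      (∃ c : ℝ, 0 < c ∧ ∀ f : ℕ → EuclideanSpace ℝ (Fin 3), (∀ n, f n ∈ Y) →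
        (∀ n, f (n + 1) ∈ {v ∈ Y | v ≠ (f n) ∧ dist (f n) v ≤ a * (1 + 1 / 50) ∧
          5 ≤ {w ∈ Y | w ≠ (f n) ∧ w ≠ v ∧ dist (f n) w ≤ a * (1 + 1 / 50) ∧
            dist v w ≤ a * (1 + 1 / 50)}.ncard}) →
        (∀ n, f (n + 2) ≠ f n) → ∀ i j : ℕ, c * |((i : ℝ) - j)| ≤ dist (f i) (f j)) := by
  intro Y a ha hgap hgreedy hH
  obtain ⟨h, hlip, h1, h2⟩ := hH
  -- the partner map and its symmetry on `Y`
  set B : ℝ := a * (1 + 1 / 50) with hB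
  let FB : EuclideanSpace ℝ (Fin 3) → Set (EuclideanSpace ℝ (Fin 3)) := fun y =>
    {v ∈ Y | v ≠ y ∧ dist y v ≤ B ∧
      5 ≤ {w ∈ Y | w ≠ y ∧ w ≠ v ∧ dist y w ≤ B ∧ dist v w ≤ B}.ncard}
  have hcomm : ∀ y v : EuclideanSpace ℝ (Fin 3),
      {w ∈ Y | w ≠ y ∧ w ≠ v ∧ dist y w ≤ B ∧ dist v w ≤ B} =
        {w ∈ Y | w ≠ v ∧ w ≠ y ∧ dist v w ≤ B ∧ dist y w ≤ B} := by
    intro y v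
    ext w
    simp only [Set.mem_setOf_eq]
    tauto
  have hsymm : ∀ y ∈ Y, ∀ v ∈ FB y, y ∈ FB v := by
    intro y hy v hv
    obtain ⟨hvY, hvy, hyv, h5⟩ := hv
    refine ⟨hy, fun e => hvy e.symm, by rwa [dist_comm], ?_⟩
    rwa [← hcomm y v]
  refine ⟨a / 10, by positivity, ?_⟩
  intro f hfY hfS hfB i j
  -- linear climb along `f`
  have hclimb := ffrQG_walk_height Y FB h hsymm h2 hfY hfS hfB
  have hδ : |h (f 1) - h (f 0)| = 1 := by
    rw [abs_sub_comm]
    exact h1 (f 0) (hfY 0) (f 1) (hfS 0)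
  have hij : |h (f i) - h (f j)| = |((i : ℝ) - j)| := by
    rw [hclimb i, hclimb j]
    have : h (f 0) + i * (h (f 1) - h (f 0)) - (h (f 0) + j * (h (f 1) - h (f 0))) =
        ((i : ℝ) - j) * (h (f 1) - h (f 0)) := by ring
    rw [this, abs_mul, hδ, mul_one]
  -- greedy path from `f j` to `f i`
  obtain ⟨n, g, hg0, hgn, hgY, hgs, hnle⟩ := hgreedy (f j) (hfY j) (f i) (hfY i)
  have hpath : |h (f i) - h (f j)| ≤ n := by
    have := ffrQG_path_height Y B h hlip hgY hgs
    rwa [hgn, hg0] at this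
  have hbound : |((i : ℝ) - j)| ≤ 4 * dist (f j) (f i) / a + 3 := by
    rw [← hij]
    exact hpath.trans hnle
  rw [dist_comm] at hbound
  -- conclude
  by_cases hij0 : i = j
  · subst hij0
    simp
  · -- distinct indices ⇒ distinct sites ⇒ hard core
    have hm : 0 < |((i : ℝ) - j)| := by
      rw [abs_pos, sub_ne_zero]
      exact_mod_cast hij0
    have hne : f i ≠ f j := by
      intro e
      rw [e, sub_self, abs_zero] at hij
      exact hm.ne' hij.symm |>.elim
    have hcore : a * (1 - 1 / 50) ≤ dist (f i) (f j) :=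
      ((hgap (f i) (hfY i)).2 (f j) (hfY j) (Ne.symm hne)).1
    by_cases h9 : |((i : ℝ) - j)| ≤ 9
    · nlinarith
    · push Not at h9
      have hmul : |((i : ℝ) - j)| * a ≤ 4 * dist (f i) (f j) + 3 * a := by
        have := mul_le_mul_of_nonneg_right hbound ha.le
        rwa [add_mul, div_mul_cancel₀ _ ha.ne'] at this
      nlinarith

end Summit.AtomisticToContinuum.Crystallization.Theorems

end
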